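import Literature.NumberTheory.EllipticCurves.ManinConstantAbbesUllmoDegreeRouteProofs
import HarnessLib

/-!
# Stub-ideas k=1 · GEN 18 — `stub_xiDegreeComparison` (crux `SteinbergCore`, stmt-ABC-15024)
# The Abbes–Ullmo seam of the one-sided ARS input (FAMILY 1: recognise & import, tree match)

Companion of `STUB-IDEAS-stub_xiDegreeComparison-1.md` (gen 18).  Everything of gens 7–17 stands
(`…_1_g11_Certificate.lean`: the registered stub ⟸ `padicValNat_congruenceNumber_eq_of_not_sq_dvd`
(ARS 2012 Thm 2.1(b)) + route item `FreyModularity`, 0 sorries, re-checked today rc 0;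
`…_1_g15_Sketch.lean`: the stub consumes only the ONE-SIDED input `OneSidedARS`;
`…_1_g17_Sketch.lean`: plan N1′ to PROVE `OneSidedARS` from `wiles1995_multiplicityOne`).

NEW here (gen 18): the one-sided input SPLITS by prime type, and its good-prime half (`p ∤ N`) is —
by Agashe–Ribet–Stein's own remark (2012, p. 3, after Thm 2.1: "[AU96, Prop. 3.3–3.4] implies the
weaker statement that if `p ∤ N`, then `ord_p(r_E) = ord_p(m_E)`") — exactly the degree relation of
Abbes–Ullmo 1996 Prop. 3.3 + 3.4, which the TREE ALREADY DISPLAYS as the hypothesis `hAU` of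
`abbesUllmo_not_dvd_maninConstant_of_not_dvd_level_of_ribet_of_degreeRelation`
(`ManinConstantAbbesUllmoDegreeRouteProofs.lean`, consumer: BSD `PublishedInputsHeckeAtTwo`), with its
functional form `ModularParametrizationData.degreeRelation_iff_pullbackIntegral` PROVED there.
So: (i) do not display/file a second copy — one named fact (AU96 Prop 3.3 ∧ 3.4) serves both
consumers; (ii) the `_holds` programme for the ARS input needs the multiplicity-one road (N1′ /
ARS Prop 5.9–5.10) ONLY at the multiplicative primes `p ∥ N`, `p ≥ 5` (`U_p = a_p = ±1 ∉ 𝔪`).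

Contents (all elaborate; `oneSidedARS_of_good_of_mult` and `oneSidedARSGood_of_degreeRelation`
are PROVED here; `OptimalDatumOnMinimalModel` is the one helper left to a prover, size M, whose
content is Edixhoven's integrality of the Manin constant of the optimal curve w.r.t. a minimal model):
* `OneSidedARS`            — verbatim k1 g15 (`…StubIdeasK1G15.OneSidedARS`), restated so this file
                             imports Literature only;
* `DegreeRelationAU`       — verbatim the type of the tree's displayed binder `hAU`;
* `OneSidedARSGood/Mult`   — the prime-type halves;  `oneSidedARS_of_good_of_mult` (proved);
* `OptimalDatumOnMinimalModel` — helper H-AU2 (statement);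
* `oneSidedARSGood_of_degreeRelation : DegreeRelationAU → OptimalDatumOnMinimalModel → OneSidedARSGood`
                           — helper H-AU1 (proved: optimal data have minimal degree,
                             `modularDegree_le_of_isogenyMap_ker_eq_bot`, so `deg D' = deg D`; drop `v_p(c) ≥ 0`).
-/

set_option linter.dupNamespace false

noncomputable section

namespace Summit.ABC.ABC.Cruxes.SteinbergCore.StubIdeasK1G18

open Literature.NumberTheory.EllipticCurves Literature.NumberTheory.EllipticCurves.ModularForms

/-- **The one-sided ARS input consumed by the stub** (verbatim k1 g15 `OneSidedARS`): for data of minimal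
degree among data with the same newform, `p ≥ 5`, `p² ∤ N`: `ord_p(r_{D.f}) ≤ ord_p(deg D)`.
[cite: AgasheRibetStein2012, Thm. 2.1 (one direction)] -/
def OneSidedARS : Prop :=
  ∀ (W : WeierstrassCurve ℚ) [W.IsElliptic] (N : ℕ) [NeZero N] (D : ModularParametrizationData W N),
    (∀ (W' : WeierstrassCurve ℚ) [W'.IsElliptic] (D' : ModularParametrizationData W' N),
        D'.f = D.f → D.modularDegree ≤ D'.modularDegree) →
      ∀ p : ℕ, p.Prime → 5 ≤ p → ¬ p ^ 2 ∣ N →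
        padicValNat p (congruenceNumber D.f) ≤ padicValNat p D.modularDegree

/-- The tree's named fact (ARS Thm 2.1(b), equality) implies the one-sided input (as in g15). -/
theorem oneSidedARS_of_ARS (h : padicValNat_congruenceNumber_eq_of_not_sq_dvd) : OneSidedARS :=
  fun W _ N _ D hmin p hp _ hsq => (h W N D hmin p hp hsq).le

/-- **Good-prime half** (`p ∤ N`). -/
def OneSidedARSGood : Prop :=
  ∀ (W : WeierstrassCurve ℚ) [W.IsElliptic] (N : ℕ) [NeZero N] (D : ModularParametrizationData W N),
    (∀ (W' : WeierstrassCurve ℚ) [W'.IsElliptic] (D' : ModularParametrizationData W' N),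
        D'.f = D.f → D.modularDegree ≤ D'.modularDegree) →
      ∀ p : ℕ, p.Prime → 5 ≤ p → ¬ p ∣ N →
        padicValNat p (congruenceNumber D.f) ≤ padicValNat p D.modularDegree

/-- **Multiplicative-prime half** (`p ∥ N`): the only place where multiplicity one (Wiles 1995 Thm 2.1 (ii) /
DDT Thm 4.26 (b), tree fact `wiles1995_multiplicityOne` with `T_p ∉ 𝔪`; or ARS 2012 Prop. 5.10, §5.2) is needed.
[cite: AgasheRibetStein2012, Thm. 3.6(b) proof (p. 13), Prop. 5.9, Lemma 5.8, Prop. 5.10] -/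
def OneSidedARSMult : Prop :=
  ∀ (W : WeierstrassCurve ℚ) [W.IsElliptic] (N : ℕ) [NeZero N] (D : ModularParametrizationData W N),
    (∀ (W' : WeierstrassCurve ℚ) [W'.IsElliptic] (D' : ModularParametrizationData W' N),
        D'.f = D.f → D.modularDegree ≤ D'.modularDegree) →
      ∀ p : ℕ, p.Prime → 5 ≤ p → p ∣ N → ¬ p ^ 2 ∣ N →
        padicValNat p (congruenceNumber D.f) ≤ padicValNat p D.modularDegree

/-- The prime-type split (proved). -/
theorem oneSidedARS_of_good_of_mult (h₁ : OneSidedARSGood) (h₂ : OneSidedARSMult) : OneSidedARS := by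
  intro W _ N _ D hmin p hp h5 hsq
  by_cases hpN : p ∣ N
  · exact h₂ W N D hmin p hp h5 hpN hsq
  · exact h₁ W N D hmin p hp h5 hpN

/-- **The displayed Abbes–Ullmo hypothesis of the tree**, VERBATIM the type of the binder `hAU` of
`abbesUllmo_not_dvd_maninConstant_of_not_dvd_level_of_ribet_of_degreeRelation`
(`ManinConstantAbbesUllmoDegreeRouteProofs.lean`): for optimal data of globally minimal models, `r ≠ 0` and
`v_p(r) + v_p(c) ≤ v_p(deg φ)` at every `p ∤ N` (AU96 Prop. 3.3 with Prop. 3.4; functional form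
`degreeRelation_iff_pullbackIntegral`). [cite: AbbesUllmo1996, Prop. 3.3, Prop. 3.4 (pp. 276–277)]
[cite: AgasheRibetStein2012, p. 3 (remark after Thm. 2.1)] -/
def DegreeRelationAU : Prop :=
  ∀ (W' : WeierstrassCurve ℚ) [W'.IsElliptic] [W'.IsGloballyMinimal] {N' : ℕ} [NeZero N']
    (D' : ModularParametrizationData W' N'),
    (∀ z ∈ D'.L.lattice, ∃ w ∈ periodLattice D'.f, z = D'.c * w) →
    congruenceNumber D'.f ≠ 0 ∧
      ∀ p : ℕ, p.Prime → ¬ p ∣ N' →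
        padicValNat p (congruenceNumber D'.f) + padicValInt p D'.maninConstant ≤
          padicValNat p D'.modularDegree

/-- Sanity: `DegreeRelationAU` is literally the tree's binder type — it feeds the tree theorem unchanged. -/
example (hR : modularDegree_dvd_congruenceNumber) (hAU : DegreeRelationAU) :
    abbesUllmo_not_dvd_maninConstant_of_not_dvd_level :=
  abbesUllmo_not_dvd_maninConstant_of_not_dvd_level_of_ribet_of_degreeRelation hR hAU

/-- **Helper H-AU2 (to prove, size M)** — an optimal datum on a GLOBALLY MINIMAL model: every datum `D`
has, at the same level and with the same newform, an optimal datum (`Λ_E = c Λ_f`) of a globally minimal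
elliptic `W'`. The tree's `ModularParametrizationData.exists_optimalDatum'` gives an optimal datum with
`c = 1` on the model `W₀` whose Néron lattice is `Λ_f`; transporting it to the minimal model of `W₀`
(`hasGlobalMinimalModel_rat`) rescales `L` by the change-of-variables unit `u` and replaces `c = 1` by
`c' = u^{∓1}`, which is an INTEGER exactly by the integrality of the Manin constant of the optimal curve
(Edixhoven 1991 Prop. 2; Agashe–Ribet–Stein 2006 "c_E is an integer"; tree: the `‖c‖_p ≤ 1` files
`ManinConstantGoodPrimesProofs` / `ManinConstantFiniteHeightPrimesProofs`).
[cite: AgasheRibetStein2006, §2] -/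
def OptimalDatumOnMinimalModel : Prop :=
  ∀ (W : WeierstrassCurve ℚ) [W.IsElliptic] (N : ℕ) [NeZero N] (D : ModularParametrizationData W N),
    ∃ (W' : WeierstrassCurve ℚ) (_ : W'.IsElliptic) (_ : W'.IsGloballyMinimal)
      (D' : ModularParametrizationData W' N),
      D'.f = D.f ∧ ∀ z ∈ D'.L.lattice, ∃ w ∈ periodLattice D'.f, z = D'.c * w

/-- **Helper H-AU1 (proved)** — the good-prime half of the one-sided ARS input from the displayed AU
hypothesis: an optimal datum has minimal degree among data with its newform
(`modularDegree_le_of_isogenyMap_ker_eq_bot`), so its degree equals that of any minimal-degree datum `D`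
with the same newform, and `v_p(r) ≤ v_p(r) + v_p(c) ≤ v_p(deg D') = v_p(deg D)`.
[cite: AbbesUllmo1996, Prop. 3.3–3.4] [cite: AgasheRibetStein2012, p. 3] -/
theorem oneSidedARSGood_of_degreeRelation (hAU : DegreeRelationAU) (hopt : OptimalDatumOnMinimalModel) :
    OneSidedARSGood := by
  intro W _ N _ D hmin p hp _h5 hpN
  obtain ⟨W', hW', hW'min, D', hf, hlat⟩ := hopt W N D
  obtain ⟨_hr, hle⟩ := hAU W' D' hlat
  have hker : D'.isogenyMap.ker = ⊥ := D'.isogenyMap_ker_eq_bot_iff.mpr hlat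
  have h₁ : D'.modularDegree ≤ D.modularDegree :=
    D'.modularDegree_le_of_isogenyMap_ker_eq_bot hker D hf.symm
  have h₂ : D.modularDegree ≤ D'.modularDegree := hmin W' D' hf
  have hdeg : D'.modularDegree = D.modularDegree := le_antisymm h₁ h₂
  have := hle p hp hpN
  rw [hf, hdeg] at this
  omega

end Summit.ABC.ABC.Cruxes.SteinbergCore.StubIdeasK1G18

end
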